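import Summits.Schanuel.Schanuel.Theorems.RootDecomp1QuadricAbsorptionPlanes

/-!
# RootDecomp1QuadricAbsorption — continuation (RootDecomp1QuadricAbsorptionMembers): §4 MEMBERS `z_R`, `z_P` certified by
Lindemann–Weierstrass alone; round 16's `z_F` re-booked without FEC

Third part of the three-file split (400-line rule) of lens 1's gen-18 node «QuadricAbsorption» (ROUND 18 of
route-Schanuel-RootDecomp1, THEOREM ROUND + CORRECTION; `--supports stmt-Schanuel-30353`); shared namespace
`Summit.Schanuel.Schanuel.Theorems.RootDecomp1QuadricAbsorption`; the first part carries the node docstring.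
Sorry-free; standard axioms.  Nothing here proves Schanuel; rung 0.
-/

noncomputable section

namespace Summit.Schanuel.Schanuel.Theorems.RootDecomp1QuadricAbsorption

open Complex IntermediateField Module Polynomial
open Literature.NumberTheory.Transcendental (algebraicIndependent_exp_holds nesterenko)
open Summit.Schanuel.Schanuel.Theorems.RootDecomp1EAnchor (isAlgebraic_of_mem_adjoin)
open Summit.Schanuel.Schanuel.Theorems.RootDecomp1EEStableRung (one_le_trdeg_adjoin_of_transcendental)
open Summit.Schanuel.Schanuel.Theorems.RootDecomp1ArgumentCells (le_trdeg_of_algebraicIndependent_mem)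
open Summit.Schanuel.Schanuel.Theorems.RootDecomp1AdditiveCells (le_trdeg_of_additive_cert)
open Summit.Schanuel.Schanuel.Theorems.RootDecomp1AdditiveCellsD (pair_one_linearIndependent)
open Summit.Schanuel.Schanuel.Theorems.RootDecomp1ResidueSieve (powerPlane powerPlane_zero powerPlane_one
  powerPlane_two powerPlane_linearIndependent two_le_argDegree_powerPlane not_isAlgebraic_of_algebraicIndependent_pair
  expPiPowerPlane algebraicIndependent_expPi_pi)

/-! ## §4  MEMBERS certified by Lindemann–Weierstrass alone: `z_R = e·(1, e^{√2}, e^{2√2})` (all real, σ-rigid)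
and `z_P = (e, e^{√2}, e^{1+√2})`; round 16's `z_F = e^π·(1, π, π²)` re-booked WITHOUT FEC. -/

/-- `√2 ∈ ℂ` is algebraic (`X² − 2`). -/
private theorem isAlgebraic_sqrt_two : IsAlgebraic ℚ (Real.sqrt 2 : ℂ) := by
  refine ⟨Polynomial.X ^ 2 - Polynomial.C 2, Polynomial.X_pow_sub_C_ne_zero (by norm_num) 2, ?_⟩
  have h2 : ((Real.sqrt 2 : ℝ) : ℂ) ^ 2 = 2 := by
    rw [← Complex.ofReal_pow, Real.sq_sqrt (by norm_num : (0 : ℝ) ≤ 2)]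
    norm_num
  simp [h2]

/-- `(1, √2)` is ℚ-free (irrationality of `√2`). -/
private theorem linearIndependent_one_sqrt_two : LinearIndependent ℚ ![(1 : ℂ), (Real.sqrt 2 : ℂ)] := by
  rw [LinearIndependent.pair_iff]
  intro s t hst
  have h : (s : ℂ) + (t : ℂ) * (Real.sqrt 2 : ℂ) = 0 := by simpa [Rat.smul_def] using hst
  have hR : (s : ℝ) + (t : ℝ) * Real.sqrt 2 = 0 := by exact_mod_cast h
  by_cases ht : t = 0
  · subst ht
    have hs : (s : ℝ) = 0 := by simpa using hR
    exact ⟨by exact_mod_cast hs, rfl⟩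
  · exfalso
    have htR : (t : ℝ) ≠ 0 := by exact_mod_cast ht
    refine irrational_sqrt_two ⟨-s / t, ?_⟩
    push_cast
    rw [div_eq_iff htR]
    linear_combination -hR

/-- Lindemann–Weierstrass (Weierstrass' form, tree theorem `algebraicIndependent_exp_holds`) for a ℚ-free pair of
algebraic exponents. -/
private theorem algebraicIndependent_exp_pair {a b : ℂ} (ha : IsAlgebraic ℚ a) (hb : IsAlgebraic ℚ b)
    (hab : LinearIndependent ℚ ![a, b]) : AlgebraicIndependent ℚ ![cexp a, cexp b] := by
  have h := algebraicIndependent_exp_holds ![a, b]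
    (fun i => by
      fin_cases i
      · simpa using ha
      · simpa using hb) hab
  convert h using 1
  funext i
  fin_cases i <;> simp

/-- **`(e, e^{√2})` is algebraically independent** (Lindemann–Weierstrass; `(1, √2)` ℚ-free). -/
theorem algebraicIndependent_exp_one_exp_sqrt_two :
    AlgebraicIndependent ℚ ![cexp 1, cexp (Real.sqrt 2 : ℂ)] :=
  algebraicIndependent_exp_pair isAlgebraic_one isAlgebraic_sqrt_two linearIndependent_one_sqrt_two

/-- The member `z_R = e·(1, e^{√2}, e^{2√2})` — an ALL-REAL power plane (σ-rigid: complex conjugation fixes it, so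
round 17's conjugate sieve is void there; no FEC grid conclusion is known there either). -/
def zR : Fin 3 → ℂ := powerPlane (cexp 1) (cexp (Real.sqrt 2 : ℂ))

/-- `z_R = (e, e^{1+√2}, e^{1+2√2})`. -/
theorem zR_eq : zR = ![cexp 1, cexp (1 + Real.sqrt 2), cexp (1 + 2 * Real.sqrt 2)] := by
  funext k
  fin_cases k
  · simp [zR]
  · simp [zR, ← Complex.exp_add]
  · simp only [zR, powerPlane_two, Fin.reduceFinMk, Matrix.cons_val]
    rw [sq, ← Complex.exp_add, ← Complex.exp_add]
    ring_nf

/-- `z_R` is ℚ-free: a genuine instance of the Schanuel format `n = 3`. -/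
theorem zR_linearIndependent : LinearIndependent ℚ zR :=
  powerPlane_linearIndependent (Complex.exp_ne_zero 1)
    (by simpa using algebraicIndependent_exp_one_exp_sqrt_two.transcendental 1)

/-- `trdeg ℚ(z_R) ≥ 2` (indeed `= 2`): `z_R` lies in the bidegree stratum `a = 2` of the D₃ sieve. -/
theorem two_le_argDegree_zR : (2 : Cardinal) ≤ Algebra.trdeg ℚ ↥(adjoin ℚ (Set.range zR)) :=
  two_le_argDegree_powerPlane algebraicIndependent_exp_one_exp_sqrt_two

/-- **MEMBER `z_R` — item D DECIDED (holds) by theorem, nothing open used:** given D's own binders at the tuple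
(the quadratic binder h5 and `ε = 0`), `3 ≤ trdeg ℚ(z_R, e^{z_R})`.  (Schanuel at `z_R` — the same inequality
without the binders — stays OPEN; no value `exp (z_R i)` is known to be transcendental.) -/
theorem member_zR
    (h5 : ∀ (k : ℕ) (t : Fin k → ℂ) (β₀ γ₀ : Fin 3 → ℂ) (β γ : Fin 3 → Fin k → ℂ) (δ ε : Fin 3 → Fin k → Fin k → ℂ),
      (∀ i, IsAlgebraic ℚ (β₀ i)) → (∀ i j, IsAlgebraic ℚ (β i j)) → (∀ i j j', IsAlgebraic ℚ (δ i j j')) →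
      (∀ i, IsAlgebraic ℚ (γ₀ i)) → (∀ i j, IsAlgebraic ℚ (γ i j)) → (∀ i j j', IsAlgebraic ℚ (ε i j j')) →
      (∀ i, zR i = β₀ i + ∑ j, β i j * t j + ∑ j, ∑ j', δ i j j' * (t j * t j')) →
      (∀ i, Complex.exp (zR i) = γ₀ i + ∑ j, γ i j * t j + ∑ j, ∑ j', ε i j j' * (t j * t j')) → 3 ≤ k)
    (hsplit : Algebra.trdeg ℚ ↥(adjoin ℚ (Set.range zR)) + Algebra.trdeg ℚ ↥(adjoin ℚ (Set.range (cexp ∘ zR))) ≤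
      Algebra.trdeg ℚ ↥(adjoin ℚ (Set.range zR ∪ Set.range (cexp ∘ zR)))) :
    ((3 : ℕ) : Cardinal) ≤ Algebra.trdeg ℚ ↥(adjoin ℚ (Set.range zR ∪ Set.range (cexp ∘ zR))) :=
  disjointSchanuel_powerPlane algebraicIndependent_exp_one_exp_sqrt_two h5 hsplit

/-- **Unconditional dichotomy at `z_R`**: either all of `e^e, e^{e^{1+√2}}, e^{e^{1+2√2}}` are algebraic (then `z_R`
is a log-type triple on a quadric cone — the QUADRATIC-IMAGE item's business), or `ε = 0 ⟹ 3 ≤ trdeg`. -/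
theorem zR_dichotomy :
    (∀ i, IsAlgebraic ℚ (cexp (zR i))) ∨
      (Algebra.trdeg ℚ ↥(adjoin ℚ (Set.range zR)) + Algebra.trdeg ℚ ↥(adjoin ℚ (Set.range (cexp ∘ zR))) ≤
          Algebra.trdeg ℚ ↥(adjoin ℚ (Set.range zR ∪ Set.range (cexp ∘ zR))) →
        ((3 : ℕ) : Cardinal) ≤ Algebra.trdeg ℚ ↥(adjoin ℚ (Set.range zR ∪ Set.range (cexp ∘ zR)))) := by
  by_cases hval : ∀ i, IsAlgebraic ℚ (cexp (zR i))
  · exact Or.inl hval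
  · refine Or.inr fun hsplit => ?_
    push Not at hval
    obtain ⟨i, hi⟩ := hval
    have hv : (1 : Cardinal) ≤ Algebra.trdeg ℚ ↥(adjoin ℚ (Set.range (cexp ∘ zR))) :=
      one_le_trdeg_adjoin_of_transcendental hi ⟨i, rfl⟩
    exact le_trdeg_of_additive_cert zR (a := 2) (v := 1) (by exact_mod_cast two_le_argDegree_zR)
      (by exact_mod_cast hv) hsplit (by norm_num)

/-- The member `z_P = (e, e^{√2}, e^{1+√2})` — a product plane (three of the four points of the grid
`{e, e^{√2}, e^{1+√2}, e^{2√2}}`; not a Four-Exponentials configuration). -/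
def zP : Fin 3 → ℂ := productPlane (cexp 1) (cexp (Real.sqrt 2 : ℂ))

/-- `z_P = (e, e^{√2}, e^{1+√2})`. -/
theorem zP_eq : zP = ![cexp 1, cexp (Real.sqrt 2), cexp (1 + Real.sqrt 2)] := by
  funext k
  fin_cases k
  · simp [zP]
  · simp [zP]
  · simp [zP, ← Complex.exp_add]

/-- `z_P` is ℚ-free. -/
theorem zP_linearIndependent : LinearIndependent ℚ zP :=
  productPlane_linearIndependent algebraicIndependent_exp_one_exp_sqrt_two

/-- **MEMBER `z_P` — item D DECIDED (holds) by theorem, nothing open used** (given its binders h5 and `ε = 0`). -/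
theorem member_zP
    (h5 : ∀ (k : ℕ) (t : Fin k → ℂ) (β₀ γ₀ : Fin 3 → ℂ) (β γ : Fin 3 → Fin k → ℂ) (δ ε : Fin 3 → Fin k → Fin k → ℂ),
      (∀ i, IsAlgebraic ℚ (β₀ i)) → (∀ i j, IsAlgebraic ℚ (β i j)) → (∀ i j j', IsAlgebraic ℚ (δ i j j')) →
      (∀ i, IsAlgebraic ℚ (γ₀ i)) → (∀ i j, IsAlgebraic ℚ (γ i j)) → (∀ i j j', IsAlgebraic ℚ (ε i j j')) →
      (∀ i, zP i = β₀ i + ∑ j, β i j * t j + ∑ j, ∑ j', δ i j j' * (t j * t j')) →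
      (∀ i, Complex.exp (zP i) = γ₀ i + ∑ j, γ i j * t j + ∑ j, ∑ j', ε i j j' * (t j * t j')) → 3 ≤ k)
    (hsplit : Algebra.trdeg ℚ ↥(adjoin ℚ (Set.range zP)) + Algebra.trdeg ℚ ↥(adjoin ℚ (Set.range (cexp ∘ zP))) ≤
      Algebra.trdeg ℚ ↥(adjoin ℚ (Set.range zP ∪ Set.range (cexp ∘ zP)))) :
    ((3 : ℕ) : Cardinal) ≤ Algebra.trdeg ℚ ↥(adjoin ℚ (Set.range zP ∪ Set.range (cexp ∘ zP))) :=
  disjointSchanuel_productPlane algebraicIndependent_exp_one_exp_sqrt_two h5 hsplit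

/-- **Round 16's member `z_F = e^π·(1, π, π²)` re-booked: item D at `z_F` needs NO Four Exponentials Conjecture**
(Nesterenko certifies membership `(e^π, π)` algebraically independent; D itself is by absorption). -/
theorem member_expPiPowerPlane_noFEC (hN : nesterenko)
    (h5 : ∀ (k : ℕ) (t : Fin k → ℂ) (β₀ γ₀ : Fin 3 → ℂ) (β γ : Fin 3 → Fin k → ℂ) (δ ε : Fin 3 → Fin k → Fin k → ℂ),
      (∀ i, IsAlgebraic ℚ (β₀ i)) → (∀ i j, IsAlgebraic ℚ (β i j)) → (∀ i j j', IsAlgebraic ℚ (δ i j j')) →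
      (∀ i, IsAlgebraic ℚ (γ₀ i)) → (∀ i j, IsAlgebraic ℚ (γ i j)) → (∀ i j j', IsAlgebraic ℚ (ε i j j')) →
      (∀ i, expPiPowerPlane i = β₀ i + ∑ j, β i j * t j + ∑ j, ∑ j', δ i j j' * (t j * t j')) →
      (∀ i, Complex.exp (expPiPowerPlane i) = γ₀ i + ∑ j, γ i j * t j + ∑ j, ∑ j', ε i j j' * (t j * t j')) →
      3 ≤ k)
    (hsplit : Algebra.trdeg ℚ ↥(adjoin ℚ (Set.range expPiPowerPlane)) +
        Algebra.trdeg ℚ ↥(adjoin ℚ (Set.range (cexp ∘ expPiPowerPlane))) ≤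
      Algebra.trdeg ℚ ↥(adjoin ℚ (Set.range expPiPowerPlane ∪ Set.range (cexp ∘ expPiPowerPlane)))) :
    ((3 : ℕ) : Cardinal) ≤
      Algebra.trdeg ℚ ↥(adjoin ℚ (Set.range expPiPowerPlane ∪ Set.range (cexp ∘ expPiPowerPlane))) :=
  disjointSchanuel_powerPlane (algebraicIndependent_expPi_pi hN) h5 hsplit

end Summit.Schanuel.Schanuel.Theorems.RootDecomp1QuadricAbsorption
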